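import Mathlib.Analysis.SpecialFunctions.Complex.Log
import Mathlib.Topology.Algebra.Order.Archimedean
import Literature.NumberTheory.Transcendental.ZilberField
import Literature.ModelTheory.Zilber.EAC
import HarnessLib

/-!
# Blurred exponential-algebraic closedness (Kirby 2019): the `H`-axis of the EAC ladder

Kirby, *Blurred complex exponentiation*, Selecta Math. (N.S.) 25 (2019) no. 72 (= arXiv:1705.04574),
blurs the graph `𝒢 = {(x, eˣ)}` of the complex exponential by a subgroup `H ≤ 𝔾ₘ(ℂ)`
(Def. 3.3): `Γ_H = {(x, y) ∈ 𝔾ₐ(ℂ) × 𝔾ₘ(ℂ) : y / exp(x) ∈ H}`, and studies the `Γ`-field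
`ℂ_H = ⟨ℂ; +, ·, Γ_H⟩`. "Taking `H = {1}`, so no blurring at all, we get `ℂ_exp` back. Taking
`H = 𝔾ₘ(F)` we get `Γ_H = G(F)`" (§3.1). The *Γ-closedness* axiom (Fact 2.3, from Kirby 2009) for a
`Γ`-field is: "for each `n ∈ ℕ`, and each rotund irreducible algebraic subvariety `V` of `Gⁿ`, the
intersection `Γⁿ ∩ V` is nonempty"; for `Γ = 𝒢` this is Zilber's exponential-algebraic closedness
(Fact 4.2: for a full `Γ`-field it is equivalent to the form restricted to free rotund `V` of
dimension `n`, i.e. to the shape of `Literature.NumberTheory.Transcendental.IsExpAlgClosed`).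

The two theorems of the paper recorded here as NAMED FACTS, hypotheses as printed:

* `kirby2019_prop_6_2` — **Prop. 6.2** (§6): "If `H` is any subgroup of `𝔾ₘ(ℂ)` which is dense
  in the complex topology then `ℂ_H` is `Γ`-closed." (Proof: density of `Hⁿ`, Ax's theorem and the
  fibre dimension theorem; no Schanuel-type input.)
* `kirby2019_thm_7_2` — **Thm. 7.2** (§7): "Let `H ⊆ 𝔾ₘ(ℂ)` be a countable subgroup which is
  dense in the complex topology. Then the structure `ℂ_H = ⟨ℂ; +, ·, Γ_H⟩` is quasiminimal. In
  particular, `ℂ^{ae}` is quasiminimal" — quasiminimal in the paper's own sense, Def. 1.2: for every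
  countable `A ⊆ M`, every `Aut(M/A)`-invariant `S ⊆ M` is countable or co-countable
  (`IsBlurredQuasiminimal`).

and, sorry-free over the tree's vocabulary (`expGraph`, `torusLocus`, `IsRotund`, `IsAddFree`,
`IsMulFree`, `zariskiDim`, `IsIrreducibleClosed` of `ExpVarieties.lean`; nothing is redefined):

* the blurred graph `blurredExpGraph K H n = Γ_Hⁿ ⊆ Gⁿ` with Kirby's two sanity checks
  `blurredExpGraph_one` (`H = {1}`: the graph of `exp`) and `blurredExpGraph_compl_zero`
  (`H = Kˣ`: all of `Gⁿ`), monotonicity in `H`, and `Γ_{H ∩ H'} = Γ_H ∩ Γ_{H'}`;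
* `IsBlurredGammaClosed K H` (Fact 2.3 form) and the level-`n` cells `BlurredECCell K H n`
  (Fact 4.2 form = `IsExpAlgClosed` with `𝒢` replaced by `Γ_H`), with
  `isExpAlgClosed_iff_forall_blurredECCell_one : IsExpAlgClosed K ↔ ∀ n, BlurredECCell K {1} n`,
  monotonicity in `H` (`BlurredECCell.mono`: EAC implies every blurred cell with `1 ∈ H`), and the
  unconditional coarsest case `isBlurredGammaClosed_compl_zero`;
* the approximate exponentiation `ℂ^{ae}`, `H = exp(ℚ + 2πiℚ)` (`approxExpSubgroup`): it is
  countable and dense (`countable_subgroupSet_approxExp`, `dense_subgroupSet_approxExp`), whence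
  Kirby's Thm. 1.6 and the `Γ`-closedness of `ℂ^{ae}` from the two facts
  (`kirby2019_thm_1_6_of_thm_7_2`, `isBlurredGammaClosed_approxExp_of_prop_6_2`);
* for `H = {1}` the automorphisms of `K_H` are exactly the exponential-field automorphisms
  (`isBlurredAut_one_iff`), so `IsBlurredQuasiminimal ℂ {1}` is Zilber's weak quasiminimality
  conjecture in Kirby's (automorphism) form, Conjecture 1.1 of the paper — NOT asserted here.

## Placement on the EAC ladder (honest framing)

The blurrings form a poset axis transverse to the `(n, d)` case ladder of `EAC.lean`: `H ≤ H'`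
gives `Γ_H ⊆ Γ_{H'}`, so `Γ`-closedness only gets easier as `H` grows. At the bottom `H = {1}` sits
EAC itself (OPEN for `ℂ_exp`; first open cell `ECCell 3 2`); at the top `H = ℂˣ` it is trivial; Kirby's
Prop. 6.2 settles every `H` DENSE in `ℂ`. The subgroup `{1}` is not dense
(`not_dense_subgroupSet_bot`), so Prop. 6.2 proves NO case of EAC for `ℂ_exp`, and nothing in this
file bears on Schanuel's conjecture (Aslanyan–Gallinaro 2024 §3.5: no implication between SC and EC
is known or expected). Between the dense subgroups and `{1}` lie the non-dense infinite subgroups —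
e.g. the unit circle (`Γ_{S¹}`: `|yᵢ| = e^{Re xᵢ}`, "EC in modulus") and the positive reals
(`Γ_{ℝ>0}`: `arg yᵢ ≡ Im xᵢ`, "EC in argument"), typed as `unitCircleSubgroup`, `posRealSubgroup`
with `Γ_{S¹} ∩ Γ_{ℝ>0} = 𝒢` (`subgroupSet_unitCircle_inter_posReal`) — for which the density
argument does not apply (`not_dense_subgroupSet_unitCircle`, `not_dense_subgroupSet_posReal`) and for
which we found no source deciding `BlurredECCell ℂ _ n`, `n ≥ 3` (for `n ≤ 2` they follow from
Aslanyan–Gallinaro 2024 §3.4 via `BlurredECCell.mono`). These cells are DEFINITIONS only; nothing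
open is asserted in this file.

## References
* J. Kirby, *Blurred complex exponentiation*, Selecta Math. (N.S.) 25 (2019) no. 72,
  doi:10.1007/s00029-019-0517-4, arXiv:1705.04574 — Def. 1.2, Fact 2.3, Def. 3.3, Fact 4.2,
  Prop. 6.2, Thm. 7.2, Thm. 1.6 (locators are the theorem / section numbers of the arXiv version;
  no page numbers are claimed).
* J. Kirby, *The theory of the exponential differential equations of semiabelian varieties*,
  Selecta Math. 15 (2009) 445–486 (source of Fact 2.3 / Fact 4.2).
* M. Bays, J. Kirby, *Pseudo-exponential maps, variants, and quasiminimality*, Algebra & Number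
  Theory 12 (2018) 493–549 (Γ-fields; Γ-closed + CCP ⟹ quasiminimal).
* V. Aslanyan, F. Gallinaro, *Zilber's exponential-algebraic closedness conjecture*, survey,
  arXiv:2409.12860 (2024), §3.4–3.5.
-/

noncomputable section

open MvPolynomial

namespace Literature.ModelTheory.Zilber

open Literature.NumberTheory.Transcendental Literature.ModelTheory.ExponentialFields

section General

variable (K : Type*) [Field K] [ExponentialRing K]

/-! ### The blurred graph `Γ_H` (Kirby 2019, Def. 3.3) -/

/-- **Kirby 2019, Definition 3.3**: for an exponential field `F` and `H` a subgroup of `𝔾ₘ(F)`,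
`Γ_H = {(x, y) ∈ G(F) : y / exp(x) ∈ H}`, `G = 𝔾ₐ × 𝔾ₘ`; equivalently `y = h · exp(x)` for some
`h ∈ H`. Stated for an arbitrary subset `H ⊆ F` (the paper's `H` is a subgroup of `Fˣ`, see
`subgroupSet`). [cite: Kirby2019Blurred, Def. 3.3 (§3.1)] -/
def blurredGraph (H : Set K) : Set (K × K) :=
  {p | ∃ h ∈ H, p.2 = h * ExponentialRing.exp p.1}

/-- `Γ_Hⁿ ⊆ Gⁿ = Kⁿ × (Kˣ)ⁿ` in the tree's coordinates (`Sum.inl` additive, `Sum.inr`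
multiplicative block): coordinatewise membership in `Γ_H`. [cite: Kirby2019Blurred, Def. 3.3 (§3.1)] -/
def blurredExpGraph (H : Set K) (n : ℕ) : Set (Fin n ⊕ Fin n → K) :=
  {z | ∀ i : Fin n, (z (Sum.inl i), z (Sum.inr i)) ∈ blurredGraph K H}

variable {K}

/-- Membership in `Γ_H`. [cite: Kirby2019Blurred, Def. 3.3 (§3.1)] -/
@[simp] theorem mem_blurredGraph_iff {H : Set K} {p : K × K} :
    p ∈ blurredGraph K H ↔ ∃ h ∈ H, p.2 = h * ExponentialRing.exp p.1 :=
  Iff.rfl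

/-- Membership in `Γ_Hⁿ`. [cite: Kirby2019Blurred, Def. 3.3 (§3.1)] -/
@[simp] theorem mem_blurredExpGraph_iff {H : Set K} {n : ℕ} {z : Fin n ⊕ Fin n → K} :
    z ∈ blurredExpGraph K H n ↔
      ∀ i, ∃ h ∈ H, z (Sum.inr i) = h * ExponentialRing.exp (z (Sum.inl i)) :=
  Iff.rfl

/-- Kirby's literal definition: `(x, y) ∈ Γ_H ↔ y / exp(x) ∈ H` (`exp x` is a unit).
[cite: Kirby2019Blurred, Def. 3.3 (§3.1)] -/
theorem mem_blurredGraph_iff_div {H : Set K} {p : K × K} :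
    p ∈ blurredGraph K H ↔ p.2 / ExponentialRing.exp p.1 ∈ H := by
  have hne : ExponentialRing.exp p.1 ≠ 0 := (ExponentialRing.isUnit_exp _).ne_zero
  constructor
  · rintro ⟨h, hh, hp⟩
    rwa [hp, mul_div_cancel_right₀ _ hne]
  · intro hp
    exact ⟨_, hp, (div_mul_cancel₀ _ hne).symm⟩

/-- `Γ_{H ∩ H'} = Γ_H ∩ Γ_{H'}` (the blurring element `h = y / exp x` is determined by the point).
[folklore] -/
theorem blurredGraph_inter (H H' : Set K) :
    blurredGraph K (H ∩ H') = blurredGraph K H ∩ blurredGraph K H' := by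
  ext p
  simp only [Set.mem_inter_iff, mem_blurredGraph_iff_div]

/-- `Γ_{H ∩ H'}ⁿ = Γ_Hⁿ ∩ Γ_{H'}ⁿ`. [folklore] -/
theorem blurredExpGraph_inter (H H' : Set K) (n : ℕ) :
    blurredExpGraph K (H ∩ H') n = blurredExpGraph K H n ∩ blurredExpGraph K H' n := by
  ext z
  simp only [blurredExpGraph, blurredGraph_inter, Set.mem_setOf_eq, Set.mem_inter_iff, forall_and]

/-- "Taking `H = {1}`, so no blurring at all, we get `F_exp` back": `Γ_{1}ⁿ` is the graph of `exp`.
[cite: Kirby2019Blurred, §3.1] -/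
theorem blurredExpGraph_one (n : ℕ) : blurredExpGraph K ({1} : Set K) n = expGraph K n := by
  ext z
  simp [mem_expGraph_iff]

/-- "Taking `H = 𝔾ₘ(F)` we get `Γ_H = G(F)`, the whole algebraic group": `Γ_{Fˣ}ⁿ = Gⁿ`.
[cite: Kirby2019Blurred, §3.1] -/
theorem blurredExpGraph_compl_zero (n : ℕ) :
    blurredExpGraph K ({0}ᶜ : Set K) n = torusLocus K n := by
  ext z
  simp only [mem_blurredExpGraph_iff, mem_torusLocus_iff, Set.mem_compl_iff, Set.mem_singleton_iff]
  refine forall_congr' fun i => ?_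
  have hne : ExponentialRing.exp (z (Sum.inl i)) ≠ 0 := (ExponentialRing.isUnit_exp _).ne_zero
  constructor
  · rintro ⟨h, hh, hz⟩
    rw [hz]
    exact mul_ne_zero hh hne
  · intro hz
    exact ⟨z (Sum.inr i) / ExponentialRing.exp (z (Sum.inl i)), div_ne_zero hz hne,
      (div_mul_cancel₀ _ hne).symm⟩

/-- `Γ_H ⊆ Γ_{H'}` for `H ⊆ H'`: blurring more only adds points. [folklore] -/
theorem blurredExpGraph_mono {H H' : Set K} (hHH' : H ⊆ H') (n : ℕ) :
    blurredExpGraph K H n ⊆ blurredExpGraph K H' n := fun z hz i => by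
  obtain ⟨h, hh, e⟩ := hz i
  exact ⟨h, hHH' hh, e⟩

/-- The graph of `exp` lies in every blurred graph with `1 ∈ H` (`𝒢 ⊆ Γ_H`, used in Kirby's proof
of Prop. 7.1). [cite: Kirby2019Blurred, Prop. 7.1 (§7)] -/
theorem expGraph_subset_blurredExpGraph {H : Set K} (h1 : (1 : K) ∈ H) (n : ℕ) :
    expGraph K n ⊆ blurredExpGraph K H n := by
  rw [← blurredExpGraph_one]
  exact blurredExpGraph_mono (Set.singleton_subset_iff.mpr h1) n

/-- A blurred graph by nonzero elements lies in `Gⁿ` (the torus locus). [folklore] -/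
theorem blurredExpGraph_subset_torusLocus {H : Set K} (h0 : (0 : K) ∉ H) (n : ℕ) :
    blurredExpGraph K H n ⊆ torusLocus K n := by
  rw [← blurredExpGraph_compl_zero]
  exact blurredExpGraph_mono (Set.subset_compl_singleton_iff.mpr h0) n

/-! ### `Γ`-closedness of `K_H` (Kirby 2019, Fact 2.3 and Fact 4.2) -/

variable (K)

/-- **`Γ`-closedness of the `Γ`-field `K_H = ⟨K; +, ·, Γ_H⟩`** (Kirby 2019, Fact 2.3, axiom
"`Γ`-closedness", from Kirby 2009 Thm. 4.11): "For each `n ∈ ℕ`, and each rotund irreducible algebraic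
subvariety `V` of `Gⁿ`, the intersection `Γⁿ ∩ V` is nonempty", with `Γ = Γ_H`. A subvariety `V` of
`Gⁿ` is presented, as in `IsExpAlgClosed`, by an irreducible Zariski closed `W ⊆ K^{2n}` meeting
`torusLocus`, `V = W ∩ torusLocus K n`; rotundity is the tree's `IsRotund` (Kirby Def. 2.2:
`dim M·V ≥ rk M` for all `M ∈ Matₙ(ℤ)`). A definition (a property of `H`), not an assertion.
[cite: Kirby2019Blurred, Fact 2.3 (§2)] -/
def IsBlurredGammaClosed (H : Set K) : Prop :=
  ∀ (n : ℕ) (W : Set (Fin n ⊕ Fin n → K)), IsIrreducibleClosed K W →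
    (W ∩ torusLocus K n).Nonempty → IsRotund K n (W ∩ torusLocus K n) →
    (W ∩ torusLocus K n ∩ blurredExpGraph K H n).Nonempty

/-- **Blurred EC cell at level `n`** (the form of Kirby 2019 Fact 4.2: "for each `n ∈ ℕ`, and each
free and rotund irreducible algebraic subvariety `V` of `Gⁿ` of dimension `n`, the intersection
`Γⁿ ∩ V` is nonempty", with `Γ = Γ_H`): literally `IsExpAlgClosed K` at level `n` with the graph of
`exp` replaced by `Γ_Hⁿ`. For `H = {1}` these cells are EAC (`isExpAlgClosed_iff_forall_blurredECCell_one`);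
a definition (a family of statements indexed by `H`, `n`), not an assertion.
[cite: Kirby2019Blurred, Fact 4.2 (§4)] -/
def BlurredECCell (H : Set K) (n : ℕ) : Prop :=
  ∀ (W : Set (Fin n ⊕ Fin n → K)), IsIrreducibleClosed K W →
    (W ∩ torusLocus K n).Nonempty → IsRotund K n (W ∩ torusLocus K n) →
    IsAddFree K n (W ∩ torusLocus K n) → IsMulFree K n (W ∩ torusLocus K n) →
    zariskiDim K W = n → (W ∩ torusLocus K n ∩ blurredExpGraph K H n).Nonempty

variable {K}

/-- `Γ`-closedness (all rotund irreducible `V`) gives every blurred cell (free rotund `V` of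
dimension `n`) — the trivial half of Kirby's Fact 4.2. [cite: Kirby2019Blurred, Fact 4.2 (§4)] -/
theorem IsBlurredGammaClosed.blurredECCell {H : Set K} (h : IsBlurredGammaClosed K H) (n : ℕ) :
    BlurredECCell K H n :=
  fun W hW hne hrot _ _ _ => h n W hW hne hrot

/-- Blurred cells are monotone in `H`. [folklore] -/
theorem BlurredECCell.mono {H H' : Set K} {n : ℕ} (h : BlurredECCell K H n) (hHH' : H ⊆ H') :
    BlurredECCell K H' n := fun W hW hne hrot hadd hmul hdim =>
  (h W hW hne hrot hadd hmul hdim).mono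
    (Set.inter_subset_inter_right _ (blurredExpGraph_mono hHH' n))

/-- `Γ`-closedness is monotone in `H`. [folklore] -/
theorem IsBlurredGammaClosed.mono {H H' : Set K} (h : IsBlurredGammaClosed K H) (hHH' : H ⊆ H') :
    IsBlurredGammaClosed K H' := fun n W hW hne hrot =>
  (h n W hW hne hrot).mono (Set.inter_subset_inter_right _ (blurredExpGraph_mono hHH' n))

/-- For `H = {1}`, `V ∩ Γ_Hⁿ = W ∩ 𝒢ⁿ`. [folklore] -/
theorem inter_torusLocus_inter_blurredExpGraph_one (n : ℕ) (W : Set (Fin n ⊕ Fin n → K)) :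
    W ∩ torusLocus K n ∩ blurredExpGraph K ({1} : Set K) n = W ∩ expGraph K n := by
  rw [blurredExpGraph_one, Set.inter_assoc, Set.inter_eq_right.mpr expGraph_subset_torusLocus]

variable (K) in
/-- **No blurring is EAC**: `IsExpAlgClosed K` is exactly the conjunction of the blurred cells for
`H = {1}` ("Taking `H = {1}` … we get `F_exp` back"). [cite: Kirby2019Blurred, §3.1] -/
theorem isExpAlgClosed_iff_forall_blurredECCell_one :
    IsExpAlgClosed K ↔ ∀ n, BlurredECCell K ({1} : Set K) n := by
  constructor
  · intro h n W hW hne hrot hadd hmul hdim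
    rw [inter_torusLocus_inter_blurredExpGraph_one]
    exact h n W hW hne hrot hadd hmul hdim
  · intro h n W hW hne hrot hadd hmul hdim
    rw [← inter_torusLocus_inter_blurredExpGraph_one]
    exact h n W hW hne hrot hadd hmul hdim

/-- EAC implies every blurred cell with `1 ∈ H` (Kirby's argument for `𝔹^{be}` in Prop. 7.1:
"`𝒢ⁿ ∩ V ≠ ∅`. But `𝒢 ⊆ Γ^{BE}`"). [cite: Kirby2019Blurred, Prop. 7.1 (§7)] -/
theorem blurredECCell_of_isExpAlgClosed {H : Set K} (h1 : (1 : K) ∈ H) (hK : IsExpAlgClosed K)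
    (n : ℕ) : BlurredECCell K H n :=
  ((isExpAlgClosed_iff_forall_blurredECCell_one K).mp hK n).mono (Set.singleton_subset_iff.mpr h1)

variable (K) in
/-- The coarsest blurring `H = Kˣ` is `Γ`-closed, unconditionally (`Γ_H = G`).
[cite: Kirby2019Blurred, §3.1] -/
theorem isBlurredGammaClosed_compl_zero : IsBlurredGammaClosed K ({0}ᶜ : Set K) := by
  intro n W hW hne hrot
  rw [blurredExpGraph_compl_zero, Set.inter_assoc, Set.inter_self]
  exact hne

end General

/-! ### Subgroups of `𝔾ₘ(K)` -/

section Subgroups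

variable (K : Type*) [Field K]

/-- The subset of `K` underlying a subgroup `H ≤ 𝔾ₘ(K) = Kˣ`. [folklore] -/
def subgroupSet (H : Subgroup Kˣ) : Set K :=
  ((↑) : Kˣ → K) '' (H : Set Kˣ)

variable {K}

/-- Membership in `subgroupSet`. [folklore] -/
theorem mem_subgroupSet_iff {H : Subgroup Kˣ} {x : K} :
    x ∈ subgroupSet K H ↔ ∃ u : Kˣ, u ∈ H ∧ (u : K) = x := by
  simp [subgroupSet]

/-- `1 ∈ H`. [folklore] -/
theorem one_mem_subgroupSet (H : Subgroup Kˣ) : (1 : K) ∈ subgroupSet K H :=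
  ⟨1, H.one_mem, Units.val_one⟩

/-- `0 ∉ H ≤ Kˣ`. [folklore] -/
theorem zero_not_mem_subgroupSet (H : Subgroup Kˣ) : (0 : K) ∉ subgroupSet K H := by
  rintro ⟨u, -, hu⟩
  exact u.ne_zero hu

/-- `subgroupSet` is monotone. [folklore] -/
theorem subgroupSet_mono {H H' : Subgroup Kˣ} (h : H ≤ H') : subgroupSet K H ⊆ subgroupSet K H' :=
  Set.image_mono h

/-- The trivial subgroup: `subgroupSet ⊥ = {1}` (no blurring). [folklore] -/
theorem subgroupSet_bot : subgroupSet K (⊥ : Subgroup Kˣ) = {1} := by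
  simp [subgroupSet]

/-- The whole group: `subgroupSet ⊤ = K ∖ {0}` (total blurring). [folklore] -/
theorem subgroupSet_top : subgroupSet K (⊤ : Subgroup Kˣ) = {0}ᶜ := by
  ext x
  simp only [subgroupSet, Subgroup.coe_top, Set.image_univ, Set.mem_range, Set.mem_compl_iff,
    Set.mem_singleton_iff]
  constructor
  · rintro ⟨u, rfl⟩
    exact u.ne_zero
  · intro hx
    exact ⟨Units.mk0 x hx, Units.val_mk0 hx⟩

end Subgroups

/-! ### Quasiminimality of `K_H` (Kirby 2019, Def. 1.2) -/

section AutQM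

variable {K : Type*} [Field K] [ExponentialRing K]

/-- `Γ_Hⁿ ⊆ Gⁿ` for a subgroup `H ≤ Kˣ`. [folklore] -/
theorem blurredExpGraph_subgroupSet_subset_torusLocus (H : Subgroup Kˣ) (n : ℕ) :
    blurredExpGraph K (subgroupSet K H) n ⊆ torusLocus K n :=
  blurredExpGraph_subset_torusLocus (zero_not_mem_subgroupSet H) n

/-- EAC implies all blurred cells of all subgroups `H ≤ Kˣ`. [cite: Kirby2019Blurred, Prop. 7.1 (§7)] -/
theorem blurredECCell_subgroupSet_of_isExpAlgClosed (hK : IsExpAlgClosed K) (H : Subgroup Kˣ)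
    (n : ℕ) : BlurredECCell K (subgroupSet K H) n :=
  blurredECCell_of_isExpAlgClosed (one_mem_subgroupSet H) hK n

variable (K) in
/-- An automorphism of the `Γ`-field `K_H = ⟨K; +, ·, Γ_H⟩`: a field automorphism `σ` of `K`
preserving the relation `Γ_H ⊆ K × K` (`(σ x, σ y) ∈ Γ_H ↔ (x, y) ∈ Γ_H`). For `H = {1}` these are
exactly the automorphisms of the exponential field (`isBlurredAut_one_iff`).
[cite: Kirby2019Blurred, Def. 1.2 and Def. 3.3] -/
def IsBlurredAut (H : Set K) (σ : K ≃+* K) : Prop :=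
  ∀ p : K × K, (σ p.1, σ p.2) ∈ blurredGraph K H ↔ p ∈ blurredGraph K H

/-- For `H = {1}`, `σ` is an automorphism of `K_H` iff it commutes with `exp`. [folklore] -/
theorem isBlurredAut_one_iff (σ : K ≃+* K) :
    IsBlurredAut K ({1} : Set K) σ ↔ ∀ x, σ (ExponentialRing.exp x) = ExponentialRing.exp (σ x) := by
  simp only [IsBlurredAut, mem_blurredGraph_iff, Set.mem_singleton_iff, exists_eq_left, one_mul]
  constructor
  · intro h x
    exact (h (x, ExponentialRing.exp x)).mpr rfl
  · intro h p
    rw [← h p.1]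
    exact σ.injective.eq_iff

variable (K) in
/-- **Kirby 2019, Definition 1.2** (quasiminimality, "the strongest reasonable version"), for the
structure `K_H = ⟨K; +, ·, Γ_H⟩`: "A structure `M` is quasiminimal if for every countable subset
`A ⊆ M` (of 'parameters') if `S ⊆ M` is invariant under `Aut(M/A)` then `S` is countable or its
complement is countable." `Aut(K_H/A)` = field automorphisms preserving `Γ_H` and fixing `A`
pointwise (`IsBlurredAut`). For `H = {1}` and `K = ℂ` this is the property of `ℂ_exp` predicted
by Zilber (statement 1.1 of the paper, in its automorphism form) — a definition here (a property of
`H`), nothing asserted. [cite: Kirby2019Blurred, Def. 1.2 (§1)] -/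
def IsBlurredQuasiminimal (H : Set K) : Prop :=
  ∀ A : Set K, A.Countable → ∀ S : Set K,
    (∀ σ : K ≃+* K, IsBlurredAut K H σ → (∀ a ∈ A, σ a = a) → ∀ x, σ x ∈ S ↔ x ∈ S) →
    S.Countable ∨ Sᶜ.Countable

end AutQM

/-! ### Kirby's theorems for `ℂ` (named facts) and the approximate exponentiation `ℂ^{ae}` -/

section Complex

/-- **Kirby 2019, Proposition 6.2** (Selecta Math. 25 (2019) no. 72 = arXiv:1705.04574, §6):
"If `H` is any subgroup of `𝔾ₘ(ℂ)` which is dense in the complex topology then `ℂ_H` is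
`Γ`-closed." `𝔾ₘ(ℂ) = ℂ ∖ {0}` is open and dense in `ℂ`, so density of `H` in `𝔾ₘ(ℂ)` is density of
`H ⊆ ℂ` in `ℂ` (`Dense (subgroupSet ℂ H)`). Proof in the paper: for `V` irreducible rotund of
dimension `n`, at a generic regular point the map `θ(x, y) = y / exp(x)` restricted to `V` is open
(Ax's theorem + the fibre dimension theorem, Lemma 6.1), so `θ(U)` meets the dense set `Hⁿ`. The
hypothesis fails for `H = {1}` (`not_dense_subgroupSet_bot`): this is NOT a case of EAC for `ℂ_exp`.
[cite: Kirby2019Blurred, Prop. 6.2 (§6)] -/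
def kirby2019_prop_6_2 : Prop :=
  ∀ H : Subgroup ℂˣ, Dense (subgroupSet ℂ H) → IsBlurredGammaClosed ℂ (subgroupSet ℂ H)

/-- **Kirby 2019, Theorem 7.2** (§7): "Let `H ⊆ 𝔾ₘ(ℂ)` be a countable subgroup which is dense in
the complex topology. Then the structure `ℂ_H = ⟨ℂ; +, ·, Γ_H⟩` is quasiminimal. In particular,
`ℂ^{ae}` is quasiminimal." (Proof: the CCP passes from `ℂ_exp` to `ℂ_H` for countable `H`,
Cor. 3.10; `ℂ_H` is `Γ`-closed by Prop. 6.2; a full `Γ`-closed `Γ`-field with the CCP is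
quasiminimal, Fact 4.7 = Bays–Kirby 2018.) Quasiminimality in the sense of the paper's Def. 1.2
(`IsBlurredQuasiminimal`). [cite: Kirby2019Blurred, Thm. 7.2 (§7)] -/
def kirby2019_thm_7_2 : Prop :=
  ∀ H : Subgroup ℂˣ, (subgroupSet ℂ H).Countable → Dense (subgroupSet ℂ H) →
    IsBlurredQuasiminimal ℂ (subgroupSet ℂ H)

/-- Prop. 6.2 at the level of cells: every blurred cell of a dense subgroup holds.
[cite: Kirby2019Blurred, Prop. 6.2 (§6)] -/
theorem blurredECCell_of_dense_of_prop_6_2 (h : kirby2019_prop_6_2) {H : Subgroup ℂˣ}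
    (hH : Dense (subgroupSet ℂ H)) (n : ℕ) : BlurredECCell ℂ (subgroupSet ℂ H) n :=
  (h H hH).blurredECCell n

/-- Per level: the blurred cell for `H = {1}` at level `n` is row `n` of the `(n, d)` case ladder of
`EAC.lean` (`ECCell n d`, `d = dim cl π(V) ∈ {0, …, n}`). [folklore] -/
theorem blurredECCell_one_iff_forall_ecCell (n : ℕ) :
    BlurredECCell ℂ ({1} : Set ℂ) n ↔ ∀ d : ℕ, ECCell n d := by
  constructor
  · intro h d W hW hne hrot hadd hmul hdim _
    rw [← inter_torusLocus_inter_blurredExpGraph_one]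
    exact h W hW hne hrot hadd hmul hdim
  · intro h W hW hne hrot hadd hmul hdim
    obtain ⟨d, -, hd⟩ := exists_nat_zariskiDim_eq (K := ℂ) (hne.image projAdd)
    rw [inter_torusLocus_inter_blurredExpGraph_one]
    exact h d W hW hne hrot hadd hmul hdim hd

/-- Rows `n ≤ 2` of every blurring with `1 ∈ H` (in particular the modulus and argument cells below)
hold, granted the printed corollary Aslanyan–Gallinaro 2024 §3.4 (`aslanyanGallinaro2024_ec_le_two`,
itself discharged from Mantova–Masser 2024 Thm. 1.1 in `EACProofs.lean`). The first rows not covered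
by the literature found are `n ≥ 3`. [cite: AslanyanGallinaro2024, §3.4 (p. 14)] -/
theorem blurredECCell_of_le_two_of_fact (hAG : aslanyanGallinaro2024_ec_le_two) {H : Set ℂ}
    (h1 : (1 : ℂ) ∈ H) {n : ℕ} (hn : n ≤ 2) : BlurredECCell ℂ H n :=
  ((blurredECCell_one_iff_forall_ecCell n).mpr fun d => hAG n d hn).mono
    (Set.singleton_subset_iff.mpr h1)

/-- The trivial subgroup `{1} ⊆ ℂ` is not dense: Prop. 6.2 does not apply to `ℂ_exp` itself.
[folklore] -/
theorem not_dense_subgroupSet_bot : ¬ Dense (subgroupSet ℂ (⊥ : Subgroup ℂˣ)) := by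
  rw [subgroupSet_bot, dense_iff_closure_eq, closure_singleton]
  intro h
  have : (0 : ℂ) ∈ ({1} : Set ℂ) := h ▸ Set.mem_univ 0
  exact zero_ne_one (Set.mem_singleton_iff.mp this)

/-! #### The approximate exponentiation `H = exp(ℚ + 2πiℚ)` (Kirby 2019 §3.1, Thm. 1.6) -/

/-- The phase `q₁ + q₂ · 2πi ∈ ℚ + 2πiℚ` of a pair of rationals. [cite: Kirby2019Blurred, §3.1] -/
def approxPhase (q : ℚ × ℚ) : ℂ :=
  (q.1 : ℂ) + (q.2 : ℂ) * (2 * Real.pi * Complex.I)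

/-- `approxPhase` is additive. [folklore] -/
theorem approxPhase_add (a b : ℚ × ℚ) : approxPhase (a + b) = approxPhase a + approxPhase b := by
  simp only [approxPhase, Prod.fst_add, Prod.snd_add, Rat.cast_add]
  ring

/-- `approxPhase 0 = 0`. [folklore] -/
theorem approxPhase_zero : approxPhase 0 = 0 := by
  simp [approxPhase]

/-- `approxPhase (-a) = -approxPhase a`. [folklore] -/
theorem approxPhase_neg (a : ℚ × ℚ) : approxPhase (-a) = -approxPhase a := by
  simp only [approxPhase, Prod.fst_neg, Prod.snd_neg, Rat.cast_neg]
  ring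

/-- **The group of the approximate exponentiation** `H = exp(ℚ + 2πiℚ) ≤ 𝔾ₘ(ℂ)` (Kirby 2019 §3.1:
"the approximate exponentiation `Γ^{AE}` is the case when `H = exp(ℚ + 2πiℚ)`"), as a subgroup of
`ℂˣ`. [cite: Kirby2019Blurred, §3.1] -/
def approxExpSubgroup : Subgroup ℂˣ where
  carrier := {u | ∃ q : ℚ × ℚ, (u : ℂ) = Complex.exp (approxPhase q)}
  one_mem' := ⟨0, by simp [approxPhase_zero]⟩
  mul_mem' := by
    rintro u v ⟨a, ha⟩ ⟨b, hb⟩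
    exact ⟨a + b, by rw [Units.val_mul, ha, hb, ← Complex.exp_add, approxPhase_add]⟩
  inv_mem' := by
    rintro u ⟨a, ha⟩
    exact ⟨-a, by rw [Units.val_inv_eq_inv_val, ha, ← Complex.exp_neg, approxPhase_neg]⟩

/-- `subgroupSet approxExpSubgroup = exp(ℚ + 2πiℚ)` as a subset of `ℂ`. [folklore] -/
theorem subgroupSet_approxExp :
    subgroupSet ℂ approxExpSubgroup = Set.range (fun q : ℚ × ℚ => Complex.exp (approxPhase q)) := by
  ext z
  simp only [mem_subgroupSet_iff, Set.mem_range]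
  constructor
  · rintro ⟨u, ⟨q, hq⟩, rfl⟩
    exact ⟨q, hq.symm⟩
  · rintro ⟨q, rfl⟩
    exact ⟨Units.mk0 _ (Complex.exp_ne_zero _), ⟨q, Units.val_mk0 _⟩, Units.val_mk0 _⟩

/-- `exp(ℚ + 2πiℚ)` is countable. [cite: Kirby2019Blurred, Thm. 7.2 (§7)] -/
theorem countable_subgroupSet_approxExp : (subgroupSet ℂ approxExpSubgroup).Countable := by
  rw [subgroupSet_approxExp]
  exact Set.countable_range _

/-- `ℚ + 2πiℚ` is dense in `ℂ` and `exp` is continuous with dense range `ℂ ∖ {0}`, so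
`exp(ℚ + 2πiℚ)` is dense in `ℂ` ("the only relevant properties of the group `H = exp(ℚ + 2πiℚ)` are
that it is countable and dense"). [cite: Kirby2019Blurred, §7] -/
theorem denseRange_exp_approxPhase :
    DenseRange (fun q : ℚ × ℚ => Complex.exp (approxPhase q)) := by
  have h1 : DenseRange (Prod.map ((↑) : ℚ → ℝ) ((↑) : ℚ → ℝ)) :=
    (Rat.denseRange_cast (𝕜 := ℝ)).prodMap (Rat.denseRange_cast (𝕜 := ℝ))
  let φ : ℝ × ℝ → ℂ := fun p => (p.1 : ℂ) + (p.2 : ℂ) * (2 * Real.pi * Complex.I)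
  have hφc : Continuous φ := by
    dsimp only [φ]
    fun_prop
  have hφs : Function.Surjective φ := by
    intro z
    refine ⟨(z.re, z.im / (2 * Real.pi)), ?_⟩
    have key : ((z.im / (2 * Real.pi) : ℝ) : ℂ) * (2 * Real.pi * Complex.I) = z.im * Complex.I := by
      have h2π : (2 * Real.pi : ℝ) ≠ 0 := (mul_pos two_pos Real.pi_pos).ne'
      have hc : (z.im / (2 * Real.pi) * (2 * Real.pi) : ℝ) = z.im := div_mul_cancel₀ _ h2π
      calc ((z.im / (2 * Real.pi) : ℝ) : ℂ) * (2 * Real.pi * Complex.I)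
          = ((z.im / (2 * Real.pi) * (2 * Real.pi) : ℝ) : ℂ) * Complex.I := by push_cast; ring
        _ = z.im * Complex.I := by rw [hc]
    show (z.re : ℂ) + ((z.im / (2 * Real.pi) : ℝ) : ℂ) * (2 * Real.pi * Complex.I) = z
    rw [key, Complex.re_add_im]
  have h2 : DenseRange (φ ∘ Prod.map ((↑) : ℚ → ℝ) ((↑) : ℚ → ℝ)) :=
    hφs.denseRange.comp h1 hφc
  have h3 : DenseRange Complex.exp := by
    rw [DenseRange, Complex.range_exp]
    exact dense_compl_singleton 0
  have h4 := h3.comp h2 Complex.continuous_exp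
  convert h4 using 1
  funext q
  simp [φ, approxPhase]

/-- `exp(ℚ + 2πiℚ)` is dense in `ℂ`. [cite: Kirby2019Blurred, §7] -/
theorem dense_subgroupSet_approxExp : Dense (subgroupSet ℂ approxExpSubgroup) := by
  rw [subgroupSet_approxExp]
  exact denseRange_exp_approxPhase

/-- **Kirby 2019, Theorem 1.6** from Thm. 7.2: "The approximate exponential field
`ℂ^{ae} = ⟨ℂ; +, ·, Γ^{AE}⟩` is quasiminimal." [cite: Kirby2019Blurred, Thm. 1.6 (§1)] -/
theorem kirby2019_thm_1_6_of_thm_7_2 (h : kirby2019_thm_7_2) :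
    IsBlurredQuasiminimal ℂ (subgroupSet ℂ approxExpSubgroup) :=
  h _ countable_subgroupSet_approxExp dense_subgroupSet_approxExp

/-- `ℂ^{ae}` is `Γ`-closed, from Prop. 6.2. [cite: Kirby2019Blurred, Prop. 6.2 (§6)] -/
theorem isBlurredGammaClosed_approxExp_of_prop_6_2 (h : kirby2019_prop_6_2) :
    IsBlurredGammaClosed ℂ (subgroupSet ℂ approxExpSubgroup) :=
  h _ dense_subgroupSet_approxExp

/-! #### Two non-dense blurrings outside the scope of Prop. 6.2: modulus and argument -/

/-- The unit circle `S¹ ≤ 𝔾ₘ(ℂ)`: `Γ_{S¹} = {(x, y) : |y| = e^{Re x}}` keeps only the modulus condition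
of `y = eˣ` ("EC in modulus"). [folklore] -/
def unitCircleSubgroup : Subgroup ℂˣ where
  carrier := {u | ‖(u : ℂ)‖ = 1}
  one_mem' := by simp
  mul_mem' := by
    intro u v hu hv
    simp only [Set.mem_setOf_eq, Units.val_mul, norm_mul] at *
    rw [hu, hv, one_mul]
  inv_mem' := by
    intro u hu
    simp only [Set.mem_setOf_eq, Units.val_inv_eq_inv_val, norm_inv] at *
    rw [hu, inv_one]

/-- The positive reals `ℝ_{>0} ≤ 𝔾ₘ(ℂ)`: `Γ_{ℝ>0} = {(x, y) : arg y ≡ Im x (mod 2π)}` keeps only the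
argument condition of `y = eˣ` ("EC in argument"). [folklore] -/
def posRealSubgroup : Subgroup ℂˣ where
  carrier := {u | ∃ r : ℝ, 0 < r ∧ (u : ℂ) = r}
  one_mem' := ⟨1, one_pos, by simp⟩
  mul_mem' := by
    rintro u v ⟨r, hr, hu⟩ ⟨s, hs, hv⟩
    exact ⟨r * s, mul_pos hr hs, by rw [Units.val_mul, hu, hv, Complex.ofReal_mul]⟩
  inv_mem' := by
    rintro u ⟨r, hr, hu⟩
    exact ⟨r⁻¹, inv_pos.mpr hr, by rw [Units.val_inv_eq_inv_val, hu, Complex.ofReal_inv]⟩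

/-- Membership in the unit-circle blurring group. [folklore] -/
theorem mem_subgroupSet_unitCircle_iff {z : ℂ} :
    z ∈ subgroupSet ℂ unitCircleSubgroup ↔ ‖z‖ = 1 := by
  rw [mem_subgroupSet_iff]
  constructor
  · rintro ⟨u, hu, rfl⟩
    exact hu
  · intro hz
    have hz0 : z ≠ 0 := fun h => by simp [h] at hz
    exact ⟨Units.mk0 z hz0, by simpa [unitCircleSubgroup] using hz, Units.val_mk0 _⟩

/-- Membership in the positive-real blurring group. [folklore] -/
theorem mem_subgroupSet_posReal_iff {z : ℂ} :
    z ∈ subgroupSet ℂ posRealSubgroup ↔ ∃ r : ℝ, 0 < r ∧ z = r := by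
  rw [mem_subgroupSet_iff]
  constructor
  · rintro ⟨u, hu, rfl⟩
    exact hu
  · rintro ⟨r, hr, rfl⟩
    have hr0 : (r : ℂ) ≠ 0 := Complex.ofReal_ne_zero.mpr hr.ne'
    exact ⟨Units.mk0 _ hr0, ⟨r, hr, Units.val_mk0 _⟩, Units.val_mk0 _⟩

/-- Modulus and argument together are no blurring: `S¹ ∩ ℝ_{>0} = {1}`, hence
`Γ_{S¹} ∩ Γ_{ℝ>0} = 𝒢` by `blurredExpGraph_inter` / `blurredExpGraph_one`. [folklore] -/
theorem subgroupSet_unitCircle_inter_posReal :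
    subgroupSet ℂ unitCircleSubgroup ∩ subgroupSet ℂ posRealSubgroup = {1} := by
  ext z
  simp only [Set.mem_inter_iff, mem_subgroupSet_unitCircle_iff, mem_subgroupSet_posReal_iff,
    Set.mem_singleton_iff]
  constructor
  · rintro ⟨hz, r, hr, rfl⟩
    rw [Complex.norm_real, Real.norm_eq_abs, abs_of_pos hr] at hz
    simp [hz]
  · rintro rfl
    exact ⟨norm_one, 1, one_pos, by simp⟩

/-- A point of `V` lies on the graph of `exp` iff it lies on both `Γ_{S¹}ⁿ` and `Γ_{ℝ>0}ⁿ`.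
[folklore] -/
theorem blurredExpGraph_unitCircle_inter_posReal (n : ℕ) :
    blurredExpGraph ℂ (subgroupSet ℂ unitCircleSubgroup) n ∩
      blurredExpGraph ℂ (subgroupSet ℂ posRealSubgroup) n = expGraph ℂ n := by
  rw [← blurredExpGraph_inter, subgroupSet_unitCircle_inter_posReal, blurredExpGraph_one]

/-- The unit circle is not dense in `ℂ` (it is closed and misses `0`): Prop. 6.2 does not apply.
[folklore] -/
theorem not_dense_subgroupSet_unitCircle : ¬ Dense (subgroupSet ℂ unitCircleSubgroup) := by
  have hS : subgroupSet ℂ unitCircleSubgroup = Metric.sphere (0 : ℂ) 1 := by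
    ext z
    simp [mem_subgroupSet_unitCircle_iff]
  rw [hS, dense_iff_closure_eq, Metric.isClosed_sphere.closure_eq]
  intro h
  have : (0 : ℂ) ∈ Metric.sphere (0 : ℂ) 1 := h ▸ Set.mem_univ 0
  simp at this

/-- The positive reals are not dense in `ℂ` (they lie in the closed proper subset `ℝ`): Prop. 6.2
does not apply. [folklore] -/
theorem not_dense_subgroupSet_posReal : ¬ Dense (subgroupSet ℂ posRealSubgroup) := by
  intro h
  have hsub : subgroupSet ℂ posRealSubgroup ⊆ Set.range ((↑) : ℝ → ℂ) := by
    rintro z hz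
    obtain ⟨r, -, rfl⟩ := mem_subgroupSet_posReal_iff.mp hz
    exact ⟨r, rfl⟩
  have hR : Dense (Set.range ((↑) : ℝ → ℂ)) := h.mono hsub
  rw [dense_iff_closure_eq, Complex.isometry_ofReal.isClosedEmbedding.isClosed_range.closure_eq] at hR
  have : Complex.I ∈ Set.range ((↑) : ℝ → ℂ) := hR ▸ Set.mem_univ _
  obtain ⟨r, hr⟩ := this
  have := congrArg Complex.im hr
  simp at this

/-! ### The translation reading of `Γ_H` over `ℂ` (ladder routine target T8) -/

/-- Translating the additive block of `Gⁿ = Kⁿ × (Kˣ)ⁿ`: `(x, y) ↦ (x + a, y)`. [folklore] -/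
def xTranslate {K : Type*} [Add K] {n : ℕ} (a : Fin n → K) (z : Fin n ⊕ Fin n → K) :
    Fin n ⊕ Fin n → K :=
  Sum.elim (fun i => z (Sum.inl i) + a i) (fun i => z (Sum.inr i))

/-- Additive coordinates of a translate. [folklore] -/
@[simp] theorem xTranslate_inl {K : Type*} [Add K] {n : ℕ} (a : Fin n → K)
    (z : Fin n ⊕ Fin n → K) (i : Fin n) : xTranslate a z (Sum.inl i) = z (Sum.inl i) + a i := rfl

/-- Multiplicative coordinates of a translate are unchanged. [folklore] -/
@[simp] theorem xTranslate_inr {K : Type*} [Add K] {n : ℕ} (a : Fin n → K)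
    (z : Fin n ⊕ Fin n → K) (i : Fin n) : xTranslate a z (Sum.inr i) = z (Sum.inr i) := rfl

/-- **Over `ℂ`, the points of `Γ_Hⁿ` are exactly the points with an additive translate by
logarithms of elements of `H` on the graph of `exp`**: for `0 ∉ H`,
`(x, y) ∈ Γ_Hⁿ ↔ ∃ a ∈ ℂⁿ, (∀ i, e^{aᵢ} ∈ H) ∧ (x + a, y) ∈ Γ_expⁿ` (take `aᵢ = log hᵢ`; uses only
that `exp : ℂ → ℂˣ` is onto). [folklore] -/
theorem mem_blurredExpGraph_iff_exists_xTranslate {H : Set ℂ} (h0 : (0 : ℂ) ∉ H) {n : ℕ}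
    (z : Fin n ⊕ Fin n → ℂ) :
    z ∈ blurredExpGraph ℂ H n ↔
      ∃ a : Fin n → ℂ, (∀ i, Complex.exp (a i) ∈ H) ∧ xTranslate a z ∈ expGraph ℂ n := by
  simp only [mem_blurredExpGraph_iff, mem_expGraph_iff, xTranslate_inl, xTranslate_inr,
    ExponentialRing.complex_exp_eq]
  constructor
  · intro h
    choose g hgH hg using h
    have hg0 : ∀ i, g i ≠ 0 := fun i h0' => h0 (h0' ▸ hgH i)
    refine ⟨fun i => Complex.log (g i), fun i => ?_, fun i => ?_⟩
    · rw [Complex.exp_log (hg0 i)]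
      exact hgH i
    · rw [Complex.exp_add, Complex.exp_log (hg0 i), hg i, mul_comm]
  · rintro ⟨a, haH, hΓ⟩ i
    exact ⟨Complex.exp (a i), haH i, by rw [hΓ i, Complex.exp_add, mul_comm]⟩

/-- **Set form (T8)**: for `0 ∉ H`, `W ∩ Γ_Hⁿ ≠ ∅ ↔` some additive translate `W + (a, 0)` with
`e^{a} ∈ Hⁿ` meets the graph of `exp` — the blurred cells ask for exponential points on the
`log H`-translates of `W`. [folklore] -/
theorem inter_blurredExpGraph_nonempty_iff_exists_xTranslate {H : Set ℂ} (h0 : (0 : ℂ) ∉ H)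
    {n : ℕ} (W : Set (Fin n ⊕ Fin n → ℂ)) :
    (W ∩ blurredExpGraph ℂ H n).Nonempty ↔
      ∃ a : Fin n → ℂ, (∀ i, Complex.exp (a i) ∈ H) ∧ (xTranslate a '' W ∩ expGraph ℂ n).Nonempty := by
  constructor
  · rintro ⟨z, hzW, hzΓ⟩
    obtain ⟨a, ha, hza⟩ := (mem_blurredExpGraph_iff_exists_xTranslate h0 z).1 hzΓ
    exact ⟨a, ha, xTranslate a z, ⟨z, hzW, rfl⟩, hza⟩
  · rintro ⟨a, ha, w, ⟨z, hzW, rfl⟩, hzΓ⟩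
    exact ⟨z, hzW, (mem_blurredExpGraph_iff_exists_xTranslate h0 z).2 ⟨a, ha, hzΓ⟩⟩

/-- The subgroup case (`0 ∉ H` automatically). [folklore] -/
theorem inter_blurredExpGraph_subgroupSet_nonempty_iff (H : Subgroup ℂˣ) {n : ℕ}
    (W : Set (Fin n ⊕ Fin n → ℂ)) :
    (W ∩ blurredExpGraph ℂ (subgroupSet ℂ H) n).Nonempty ↔
      ∃ a : Fin n → ℂ, (∀ i, Complex.exp (a i) ∈ subgroupSet ℂ H) ∧
        (xTranslate a '' W ∩ expGraph ℂ n).Nonempty :=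
  inter_blurredExpGraph_nonempty_iff_exists_xTranslate (zero_not_mem_subgroupSet H) W

/-- For the unit circle `𝕊¹`: `e^{a} ∈ 𝕊¹ ↔ a` is purely imaginary, so `W ∩ Γ_{𝕊¹}ⁿ ≠ ∅ ↔` a purely
imaginary additive translate of `W` meets `Γ_exp` ("EC in modulus"). [folklore] -/
theorem exp_mem_subgroupSet_unitCircle_iff (a : ℂ) :
    Complex.exp a ∈ subgroupSet ℂ unitCircleSubgroup ↔ a.re = 0 := by
  rw [mem_subgroupSet_unitCircle_iff, Complex.norm_exp, Real.exp_eq_one_iff]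

end Complex

end Literature.ModelTheory.Zilber
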